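import Summits.CriticalPhenomena.Ising3DConformalLimit.Theses.MirrorHoelderCompactness
import Literature.Probability.LatticeModels.CriticalTwoPointBounds
import Literature.Probability.LatticeModels.HighDimPointwiseTriviality
import HarnessLib.Audit.Check

/-!
# Birth skeleton for crux `TwoPointDoubling` (stmt-CriticalPhenomena-6150), route `MirrorHoelderCompactness`

Crux (D), rank 2 of `route-CriticalPhenomena-MirrorHoelderCompactness` (sub-problem `Ising3DConformalLimit`):
ALL-SCALE AXIS DOUBLING of the critical two-point function of the nearest-neighbour Ising model on `ℤ³`,
`∃ κ > 0, ∀ n ≥ 1, κ·g(n) ≤ g(2n)`, `g(n) := ⟨σ₀σ_{n e₀}⟩⁺_{β_c(3)} = criticalTwoPoint 3 (Pi.single 0 n)`.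
Open in print (Aizenman–Duminil-Copin 2021, Remark 5.10 and §5.6: "for now we do not have an unconditional
proof" that every scale is regular); by the landed funnel files of crux 1981
(`Theorems/…FunnelThroughDoubling.lean`, `…FunnelDoublingIffAxisRate.lean`) it is LITERALLY the log-free axial
gradient bound of ADC21 Rem. 5.10 and is equivalent to dyadic / eventual doubling, to `OrbitPrecompact` (5955),
to `UniformRegularity` (4658) and (given the landed folded-current identity) to `WallRepulsion`; none of those
equivalents is used as a stub here (that would be costume).

## The line: the DC–Panis LEAN/FAT regime split (the route's own two-layer plan
## "TwoPointDoubling ⇐ FatScaleDoubling → LeanScalePropagation → TwoPointDoubling")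

Fix a threshold `A > 0` and call a scale `k ≥ 1` *A-lean* if `g(k) ≤ A·k^(−3/2)` (at or below the `η = 1/2`
line) and *A-fat* otherwise. For the doubling inequality at scale `n` look at the window `1 ≤ k ≤ 8n`
(the scales entering Duminil-Copin–Panis' denominator `χ_{8n} + 2n·Σ_{k ≤ 4n} k g(k)` at scale `2n`):

* `stub_leanScalePropagation` (M–L, PROVABLE from print — the ENGINE): for EVERY `A > 0` there is `κ(A) > 0`
  with `κ g(n) ≤ g(2n)` at every `n ≥ 1` whose whole window `[1, 8n]` is A-lean.  Route: Duminil-Copin–Panis,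
  CMP 406 (2025) = arXiv:2404.05700, Thm 1.3 (`d = 3`, `β = β_c`, `L(β_c) = ∞`):
  `g(2n) ≥ c₁ / (χ_{8n} + 2n Σ_{k ≤ 4n} k g(k))` for `2n ≥ N₁`; the sup-norm Messager–Miracle-Solé comparison
  `G(x) ≤ g(⌊‖x‖_∞/3⌋)` (`twoPointPlus_le_of_mul_supNorm_le`, in tree) and window leanness give
  `χ_{8n} ≤ 27 + 54·A·Σ_{k ≤ 8n} k^{1/2} ≤ (27 + C A) n^{3/2}` and `2n Σ_{k ≤ 4n} k·A k^{−3/2} ≤ 8 A n^{3/2}`, so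
  `g(2n) ≥ c₁ /((27 + C′A) n^{3/2}) ≥ (c₁ /(A (27 + C′A))) · g(n)` (leanness at `k = n`); the finitely many
  `2n < N₁` by positivity (`g > 0`, Simon–Lieb).  In tree already: `dcp_reflectedGradient_lower_holds`
  (DCP Thm 1.2); Thm 1.3 is its stated corollary (spectral gradient estimate + MMS), not yet in tree.
* `stub_fatScaleDoubling` (OPEN — THE LOAD-BEARING STUB): for SOME threshold `A > 0` there is `κ > 0` with
  `κ g(n) ≤ g(2n)` at every `n ≥ 1` whose window contains an A-fat scale.  This is the honest open core: it
  contains (R2) the infrared-fat scales (`g(n) > A n^{−3/2}`, where DCP's reverse mean-value inequality returns only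
  the trivial `g(2n) ≳ n^{−2}`) and (R3) the CROSSOVER regime (`n` lean below an earlier fat plateau) — exactly
  where the completely monotone witnesses `c n^{−3/2} + C e^{−n/N}/n` (compatible with RP log-convexity
  `criticalTwoPoint_axis_ratio_mono`, MMS, `c n^{−2} ≤ g ≤ C n^{−1}` and DCP) lose doubling by `N^{−1/4}`
  (route header, why-it-might-fail of 6150; card crossover-witness-no-doubling).  Why it might be true anyway:
  numerically `g(2n)/g(n) → 2^{−2Δ_σ} ≈ 0.4875` and every scale is fat (`2Δ_σ ≈ 1.036 < 3/2`); a proof needs an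
  Ising-specific all-scale input (random-current / wall-repulsion `P[y ↮ 𝕏] ≤ A/k`, Aizenman 2025 Thm 14.2, cf.
  line `folded-current-repulsion` of crux 1981), not positivity alone.
* `TwoPointDoubling_of` (REAL PROOF, this file): take `A` from the fat stub, `κ_L := κ(A)` from the lean stub,
  `κ := min κ_L κ_F`; every `n ≥ 1` has an all-lean window or a fat scale in it (excluded middle on the finite
  window), and `min κ_L κ_F · g(n) ≤ κ_• · g(n)` by `g ≥ 0`.

Neither stub is cheaply the crux: (D) ⟹ each stub trivially, but `stub_leanScalePropagation ⟹ (D)` would need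
every scale to be A-lean for one `A` (i.e. `g ≤ A k^{−3/2}`, an improvement of the infrared bound = "η ≥ 1/2",
open and numerically false), and `stub_fatScaleDoubling ⟹ (D)` needs the lean engine (its `A` may be so large
that most windows are all-lean).  Neither is trivially provable: the lean stub at large `A` is non-vacuous
(`n = 1` qualifies once `A ≥ max_{k ≤ 8} k^{3/2} g(k)`), and choosing `A` huge in the fat stub would require the
same open bound `g ≤ A k^{−3/2}`.  BC3 probes (`stub → TwoPointDoubling`, `stub → Ising3DConformalLimit` by
`first | exact? | simpa | aesop`) are recorded in the planner folder (`bc/TwoPointDoubling_probe.lean`) and in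
`BC3-birth.md` on the crux.

Disproof used: none on file (`ledger crux ls stmt-CriticalPhenomena-6150`: no `Disproof.lean`; no
`Theorems/TwoPointDoubling/Negative/`).  Negatives index (`ledger negatives --problem CriticalPhenomena`, 2026-08-17:
11 refuted statements, all in CardyFormulaZ2 / PercolationContinuityZ3 / SAWScalingLimit): none concerns
`criticalTwoPoint 3` or axis doubling; the stubs are restrictions of the OPEN item 6150 to regimes, not instances of
a refuted strengthening (no rate, no explicit `κ`, no pure power law is asserted).
-/

noncomputable section

namespace Summit.CriticalPhenomena.Ising3DConformalLimit.Cruxes.TwoPointDoubling.Birth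

open scoped BigOperators Topology Classical
open Filter Set Function
open Literature.Probability.LatticeModels

/-! ## The two registered stubs (signatures fully qualified, over importable vocabulary only) -/

/-- **STUB 1 · `stub_leanScalePropagation` (M–L, provable from print) — doubling propagates through LEAN windows.**
For every threshold `A > 0` there is `κ > 0` such that `κ·g(n) ≤ g(2n)` for every `n ≥ 1` all of whose scales
`1 ≤ k ≤ 8n` satisfy `g(k) ≤ A·k^(−3/2)`; `g(k) = criticalTwoPoint 3 (Pi.single 0 k)`.  Route: Duminil-Copin–Panis
Thm 1.3 at `d = 3`, `β = β_c` (`g(2n) ≥ c₁/(χ_{8n} + 2n Σ_{k≤4n} k g(k))`, `2n ≥ N₁`) + sup-norm MMS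
(`twoPointPlus_le_of_mul_supNorm_le`) to bound the denominator by `(27 + C A) n^{3/2}` on an A-lean window +
leanness at `k = n`; small `n` by positivity.  [arXiv:2404.05700 Thm 1.2–1.3; AizenmanDuminilCopinAnnals2021 §5.1,
§5.5; MessagerMiracleSoleJSP1977; in tree: dcp_reflectedGradient_lower_holds, criticalTwoPoint_bounds_holds] -/
theorem stub_leanScalePropagation :
    ∀ A : ℝ, 0 < A → ∃ κ : ℝ, 0 < κ ∧ ∀ n : ℕ, 1 ≤ n →
      (∀ k : ℕ, 1 ≤ k → k ≤ 8 * n →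
        Literature.Probability.LatticeModels.criticalTwoPoint 3 (Pi.single 0 (k : ℤ)) ≤ A * (k : ℝ) ^ (-(3 : ℝ) / 2)) →
      κ * Literature.Probability.LatticeModels.criticalTwoPoint 3 (Pi.single 0 (n : ℤ)) ≤
        Literature.Probability.LatticeModels.criticalTwoPoint 3 (Pi.single 0 (2 * (n : ℤ))) := by
  sorry

/-- **STUB 2 · `stub_fatScaleDoubling` (OPEN — load-bearing) — doubling at scales with a FAT scale in the window.**
For some threshold `A > 0` there is `κ > 0` such that `κ·g(n) ≤ g(2n)` for every `n ≥ 1` having a scale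
`1 ≤ k ≤ 8n` with `g(k) > A·k^(−3/2)`.  Contains the infrared-fat regime and the crossover regime (lean `n` below a
fat plateau), where the completely monotone profiles `c n^{−3/2} + C e^{−n/N}/n` allowed by RP/MMS/IR/DCP lose
doubling by `N^{−1/4}`; needs an Ising-specific input (random currents / wall repulsion), not positivity.
Why plausible: `g(2n)/g(n) → 2^{−2Δ_σ} ≈ 0.4875` numerically, all scales fat.  [AizenmanDuminilCopinAnnals2021
Rem 5.10, Def 5.11, Thm 5.12; arXiv:2404.05700 Thm 1.5; DuminilCopinICM2022 §8.4; arXiv:2509.02850 Thm 14.2] -/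
theorem stub_fatScaleDoubling :
    ∃ A : ℝ, 0 < A ∧ ∃ κ : ℝ, 0 < κ ∧ ∀ n : ℕ, 1 ≤ n →
      (∃ k : ℕ, 1 ≤ k ∧ k ≤ 8 * n ∧
        A * (k : ℝ) ^ (-(3 : ℝ) / 2) < Literature.Probability.LatticeModels.criticalTwoPoint 3 (Pi.single 0 (k : ℤ))) →
      κ * Literature.Probability.LatticeModels.criticalTwoPoint 3 (Pi.single 0 (n : ℤ)) ≤
        Literature.Probability.LatticeModels.criticalTwoPoint 3 (Pi.single 0 (2 * (n : ℤ))) := by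
  sorry

/-! ## Names for the statements (hypotheses of the composition)

The layer-invariant audit admits, as hypotheses of the theorem that concludes the crux, only registered
obligations or the declared stubs BY NAME; `Statement.stub_x` is the statement of `stub_x` (its `type_of%`). -/

namespace Statement

/-- Statement of `stub_leanScalePropagation`. -/
abbrev stub_leanScalePropagation : Prop := type_of% Birth.stub_leanScalePropagation
/-- Statement of `stub_fatScaleDoubling`. -/
abbrev stub_fatScaleDoubling : Prop := type_of% Birth.stub_fatScaleDoubling

end Statement

/-! ## Local shorthand (verbatim sub-term of the route decl), certified by `Iff.rfl` -/

/-- `g(m) = ⟨σ₀σ_{m e₀}⟩⁺_{β_c(3)}` for an integer axis coordinate `m`. -/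
def g (m : ℤ) : ℝ := Literature.Probability.LatticeModels.criticalTwoPoint 3 (Pi.single 0 m)

/-- The crux, read through `g`. -/
theorem crux_iff :
    Summit.CriticalPhenomena.Ising3DConformalLimit.Theses.MirrorHoelderCompactness.TwoPointDoubling ↔
      ∃ κ : ℝ, 0 < κ ∧ ∀ n : ℕ, 1 ≤ n → κ * g (n : ℤ) ≤ g (2 * (n : ℤ)) :=
  Iff.rfl

/-- `stub_leanScalePropagation`, read through `g`. -/
theorem stub_leanScalePropagation_iff :
    Statement.stub_leanScalePropagation ↔
      ∀ A : ℝ, 0 < A → ∃ κ : ℝ, 0 < κ ∧ ∀ n : ℕ, 1 ≤ n →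
        (∀ k : ℕ, 1 ≤ k → k ≤ 8 * n → g (k : ℤ) ≤ A * (k : ℝ) ^ (-(3 : ℝ) / 2)) →
        κ * g (n : ℤ) ≤ g (2 * (n : ℤ)) :=
  Iff.rfl

/-- `stub_fatScaleDoubling`, read through `g`. -/
theorem stub_fatScaleDoubling_iff :
    Statement.stub_fatScaleDoubling ↔
      ∃ A : ℝ, 0 < A ∧ ∃ κ : ℝ, 0 < κ ∧ ∀ n : ℕ, 1 ≤ n →
        (∃ k : ℕ, 1 ≤ k ∧ k ≤ 8 * n ∧ A * (k : ℝ) ^ (-(3 : ℝ) / 2) < g (k : ℤ)) →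
        κ * g (n : ℤ) ≤ g (2 * (n : ℤ)) :=
  Iff.rfl

/-! ## Elementary facts used by the composition (proved) -/

/-- `0 ≤ g(m)` (Griffiths' first inequality; in tree `criticalTwoPoint_nonneg'`). [folklore] -/
theorem g_nonneg (m : ℤ) : 0 ≤ g m := criticalTwoPoint_nonneg' _

/-- The regime dichotomy on the finite window `[1, 8n]` at threshold `A`: either every scale is A-lean or some
scale is A-fat (excluded middle; recorded as a lemma because it is the seam of the composition). [folklore] -/
theorem window_lean_or_fat (A : ℝ) (n : ℕ) :
    (∀ k : ℕ, 1 ≤ k → k ≤ 8 * n → g (k : ℤ) ≤ A * (k : ℝ) ^ (-(3 : ℝ) / 2)) ∨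
      (∃ k : ℕ, 1 ≤ k ∧ k ≤ 8 * n ∧ A * (k : ℝ) ^ (-(3 : ℝ) / 2) < g (k : ℤ)) := by
  by_cases h : ∀ k : ℕ, 1 ≤ k → k ≤ 8 * n → g (k : ℤ) ≤ A * (k : ℝ) ^ (-(3 : ℝ) / 2)
  · exact Or.inl h
  · push Not at h
    obtain ⟨k, hk1, hk8, hlt⟩ := h
    exact Or.inr ⟨k, hk1, hk8, hlt⟩

/-! ## The composition (kernel-checked, no sorry): the two stubs give the crux BY NAME -/

/-- **`TwoPointDoubling` from the stubs.**  Take the threshold `A` and the constant `κ_F` of the fat stub, the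
constant `κ_L = κ(A)` of the lean stub at that threshold, and `κ := min κ_L κ_F > 0`; at each `n ≥ 1` the window
`[1, 8n]` is all-lean (lean stub) or contains a fat scale (fat stub), and `min κ_L κ_F · g(n) ≤ κ_• · g(n)` because
`g(n) ≥ 0`. -/
theorem TwoPointDoubling_of (h₁ : Statement.stub_leanScalePropagation) (h₂ : Statement.stub_fatScaleDoubling) :
    Summit.CriticalPhenomena.Ising3DConformalLimit.Theses.MirrorHoelderCompactness.TwoPointDoubling := by
  rw [stub_leanScalePropagation_iff] at h₁
  rw [stub_fatScaleDoubling_iff] at h₂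
  rw [crux_iff]
  obtain ⟨A, hA, κF, hκF, hfat⟩ := h₂
  obtain ⟨κL, hκL, hlean⟩ := h₁ A hA
  refine ⟨min κL κF, lt_min hκL hκF, fun n hn => ?_⟩
  rcases window_lean_or_fat A n with hwin | hwin
  · calc min κL κF * g (n : ℤ) ≤ κL * g (n : ℤ) :=
          mul_le_mul_of_nonneg_right (min_le_left _ _) (g_nonneg _)
      _ ≤ g (2 * (n : ℤ)) := hlean n hn hwin
  · calc min κL κF * g (n : ℤ) ≤ κF * g (n : ℤ) :=
          mul_le_mul_of_nonneg_right (min_le_right _ _) (g_nonneg _)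
      _ ≤ g (2 * (n : ℤ)) := hfat n hn hwin

end Summit.CriticalPhenomena.Ising3DConformalLimit.Cruxes.TwoPointDoubling.Birth

end
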